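import Mathlib.Algebra.MvPolynomial.Funext
import Mathlib.Algebra.Ring.GeomSum
import Mathlib.LinearAlgebra.Matrix.SchurComplement
import Mathlib.RingTheory.Localization.FractionRing
import Mathlib.RingTheory.MvPolynomial.Basic
import Literature.LinearAlgebra.Matrix.RankMinors
import Literature.Computability.AlgebraicComplexity.HankelRank
import HarnessLib

/-!
# The apolarity (cactus) bound for linear rank methods on a monomial chart

Topic `Literature/Computability/AlgebraicComplexity`. An elementary, coordinate proof of the
mechanism of Buczyński's cactus barrier (arXiv:2602.11309, Thm. 2 / Thm. 9–10 / Cor. 13) in the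
generality needed by the tree: let `α : I → (σ →₀ ℕ)` be finitely many distinct exponents and
`χ(y) = (y^{α i})_i ∈ F^I` the points of the monomial chart (`MonomialChart.point`), `F` an
infinite field. If a linear map `L : F^I → Mat_{p × q}(F)` (a matrix of linear forms) has
`rk L(χ(y)) ≤ k` at every point, then for EVERY `t ∈ F^I`

  `rk L(t) ≤ k · rk H_t`,                                    (`rank_le_mul_rank_hankel`)

where `H_t` is the Hankel (catalecticant) matrix of `t` on the downward closure of the exponents
(`MonomialChart.hankel`): `t` lies in the span of the local apolar scheme of `φ_t`, supported at
the origin of the chart, whose length is `rk H_t`.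

## Proof (mirrors Buczyński §2–§4 in coordinates)

* `MonomialChart.polyMatrix`: the matrix of polynomials `M(X) = Σ_i X^{α i} L(e_i)`,
  `M(y) = L(χ(y))`, and `φ_t(M) = L(t)` (`MonomialChart.map_phi_polyMatrix`).
* Translation (Prop. 3 of the source): `M(X + c)` (`MonomialChart.shift`), generic in `c` via
  the tree's integer Taylor coefficients (`Taylor.taylorCoeff`, `IntegerTaylor.lean`), so that
  `c ↦ φ_t(M(X + c))` is a polynomial map (`MonomialChart.genericPhiMatrix`);
  `coeff_pow_mul_eq_zero`: `e^N x` has no low monomials.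
* Constant rank ⇒ factorisation (Thm. 9 with Lemmas 4–6): if a `k₀ × k₀` minor `g` of `M(X+c)`
  has `g(0) ≠ 0` and all `(k₀+1)`-minors vanish identically, then `g · M = P · adj · Q` over the
  polynomial ring (bordered minors, via the fraction field and `Matrix.det_fromBlocks₁₁`;
  `det_smul_eq_mul_adjugate_mul`), and since `g` is invertible modulo the
  monomials `φ_t` cannot see, `φ_t(M) = φ_t(P̃ Q)` with `P̃` of `k₀` columns, so
  `rk φ_t(M(X+c)) ≤ k₀ · rk H_t` (`rank_map_phi_le_of_minor`, using
  `MonomialChart.rank_map_phi_mul_le` of `HankelRank.lean`).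
* Density (Thm. 8 / Thm. 10): the points `c` of maximal rank `k₀ ≤ k` form a non-empty Zariski
  open set, the bound holds there, and minors of the polynomial matrix `φ_t(M(X + c))` that vanish
  on it vanish at `c = 0` (`MvPolynomial.funext`), where the matrix is `L(t)`.

References: Buczyński 2026 (as above); EGOW 2018 (arXiv:1710.09502) §3–4 for the same local
factorisation in the tensor/Waring cases. The coordinate formulation and this proof are ours.
-/

noncomputable section

open scoped BigOperators
open MvPolynomial

namespace Literature.Computability.AlgebraicComplexity

namespace MonomialChart

variable {F : Type*} [Field F]
variable {σ : Type*} {I : Type*}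
variable {p q : Type*}

/-! ## Low-order vanishing -/

section Order

variable [DecidableEq σ]

/-- If `e` has no constant term then `e^N · x` has no monomial of degree `< N`. [folklore] -/
theorem coeff_pow_mul_eq_zero {e : MvPolynomial σ F} (he : constantCoeff e = 0) :
    ∀ (N : ℕ) (x : MvPolynomial σ F) (β : σ →₀ ℕ), β.degree < N → coeff β (e ^ N * x) = 0
  | 0, _, _, h => (Nat.not_lt_zero _ h).elim
  | N + 1, x, β, h => by
    rw [pow_succ', mul_assoc, coeff_mul]
    refine Finset.sum_eq_zero fun γ hγ => ?_
    rw [Finset.mem_antidiagonal] at hγ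
    by_cases h0 : γ.1 = 0
    · rw [h0, ← constantCoeff_eq, he, zero_mul]
    · have hdeg : β.degree = γ.1.degree + γ.2.degree := by rw [← hγ, map_add]
      have h1 : γ.1.degree ≠ 0 := fun h' => h0 ((Finsupp.degree_eq_zero_iff _).1 h')
      rw [coeff_pow_mul_eq_zero he N x γ.2 (by omega), mul_zero]

end Order

/-! ## Constant rank: local factorisation and the bound at a good translate -/

section Local

/-- **Bordered minors** (the affine form of Buczyński's Thm. 9). Let `M'` be a matrix over the
polynomial ring all of whose `(k₀+1)`-minors vanish, and `A = M'[r, cc]` a `k₀ × k₀` block with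
`det A ≠ 0`. Then `det A · M' = M'[·, cc] · adj A · M'[r, ·]`. [folklore] -/
theorem det_smul_eq_mul_adjugate_mul {k₀ : ℕ} (M' : Matrix p q (MvPolynomial σ F))
    (hmin : ∀ (ι : Type) [Fintype ι] [DecidableEq ι] (r' : ι → p) (c' : ι → q),
      k₀ < Fintype.card ι → (M'.submatrix r' c').det = 0)
    (r : Fin k₀ → p) (cc : Fin k₀ → q) (hA : (M'.submatrix r cc).det ≠ 0) :
    (M'.submatrix r cc).det • M' =
      M'.submatrix id cc * (M'.submatrix r cc).adjugate * M'.submatrix r id := by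
  classical
  set A : Matrix (Fin k₀) (Fin k₀) (MvPolynomial σ F) := M'.submatrix r cc with hAdef
  let K := FractionRing (MvPolynomial σ F)
  let ι₀ : MvPolynomial σ F →+* K := algebraMap (MvPolynomial σ F) K
  have hinj : Function.Injective ι₀ := IsFractionRing.injective (MvPolynomial σ F) K
  refine Matrix.ext fun a b => ?_
  -- the bordered `(k₀+1)`-minor through row `a` and column `b`
  set Bc : Matrix (Fin k₀) Unit (MvPolynomial σ F) := fun i _ => M' (r i) b with hBc
  set Cr : Matrix Unit (Fin k₀) (MvPolynomial σ F) := fun _ j => M' a (cc j) with hCr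
  set D : Matrix Unit Unit (MvPolynomial σ F) := fun _ _ => M' a b with hD
  have hblk : Matrix.fromBlocks A Bc Cr D =
      M'.submatrix (Sum.elim r fun _ => a) (Sum.elim cc fun _ => b) := by
    refine Matrix.ext ?_
    rintro (i | i) (j | j) <;> rfl
  have hdet : (Matrix.fromBlocks A Bc Cr D).det = 0 := by
    rw [hblk]; exact hmin (Fin k₀ ⊕ Unit) _ _ (by simp)
  -- pass to the fraction field, where `A` is invertible
  have hdetA : (A.map ι₀).det = ι₀ A.det := by
    rw [RingHom.map_det, RingHom.mapMatrix_apply]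
  have hAK : (A.map ι₀).det ≠ 0 := by
    rw [hdetA]; exact fun h => hA (hinj (by rw [h, map_zero]))
  letI : Invertible (A.map ι₀).det := invertibleOfNonzero hAK
  letI : Invertible (A.map ι₀) := Matrix.invertibleOfDetInvertible _
  have hK : (Matrix.fromBlocks (A.map ι₀) (Bc.map ι₀) (Cr.map ι₀) (D.map ι₀)).det = 0 := by
    rw [← Matrix.fromBlocks_map, ← RingHom.mapMatrix_apply, ← RingHom.map_det, hdet, map_zero]
  rw [Matrix.det_fromBlocks₁₁] at hK
  have hK2 : (D.map ι₀ - Cr.map ι₀ * ⅟(A.map ι₀) * Bc.map ι₀).det = 0 :=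
    (mul_eq_zero.1 hK).resolve_left hAK
  have hadj : (A.adjugate).map ι₀ = (A.map ι₀).adjugate := by
    simpa only [RingHom.mapMatrix_apply] using RingHom.map_adjugate ι₀ A
  have hinvOf : ⅟(A.map ι₀) = ((A.map ι₀).det)⁻¹ • (A.adjugate).map ι₀ := by
    rw [Matrix.invOf_eq_nonsing_inv, Matrix.inv_def, Ring.inverse_eq_inv, hadj]
  rw [Matrix.det_unique, Matrix.sub_apply, sub_eq_zero, hinvOf, Matrix.mul_smul,
    Matrix.smul_mul, Matrix.smul_apply, smul_eq_mul, ← Matrix.map_mul, ← Matrix.map_mul,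
    Matrix.map_apply, Matrix.map_apply] at hK2
  -- `hK2 : ι₀ (M' a b) = (det A_K)⁻¹ * ι₀ ((Cr * adj A * Bc) () ())`; clear the denominator
  have hK3 : ι₀ (A.det * M' a b) = ι₀ ((Cr * A.adjugate * Bc) default default) := by
    rw [map_mul, ← hdetA]
    change (A.map ι₀).det * ι₀ (D default default) = _
    rw [hK2, ← mul_assoc, mul_inv_cancel₀ hAK, one_mul]
  have hS : A.det * M' a b = (Cr * A.adjugate * Bc) default default := hinj hK3
  rw [Matrix.smul_apply, smul_eq_mul, hS]
  simp only [Matrix.mul_apply, Matrix.submatrix_apply, id, hBc, hCr]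

/-- **The bound at a translate of maximal rank** (affine Thm. 9 + Lemma 5). If `M(X + c)` has a
`k₀ × k₀` minor that is non-zero at `X = 0` while all its `(k₀+1)`-minors vanish identically, then
`rk φ_t(M(X + c)) ≤ k₀ · rk H_t`. [cite: Buczynski2026, Thm. 9] -/
theorem rank_map_phi_le_of_minor [DecidableEq σ] [Fintype I] [Fintype q] {k₀ : ℕ}
    (α : I → σ →₀ ℕ) (t : I → F)
    (M' : Matrix p q (MvPolynomial σ F))
    (hmin : ∀ (ι : Type) [Fintype ι] [DecidableEq ι] (r' : ι → p) (c' : ι → q),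
      k₀ < Fintype.card ι → (M'.submatrix r' c').det = 0)
    (r : Fin k₀ → p) (cc : Fin k₀ → q) (h0 : constantCoeff (M'.submatrix r cc).det ≠ 0) :
    (M'.map (phi α t)).rank ≤ k₀ * (hankel α t).rank := by
  classical
  have hfac := det_smul_eq_mul_adjugate_mul M' hmin r cc (fun h => h0 (by rw [h, map_zero]))
  set A := M'.submatrix r cc with hAdef
  set g := A.det with hg
  have hA : g ≠ 0 := fun h => h0 (by rw [h, map_zero])
  -- invert `g` modulo high order: `f g = 1 - e^N`
  set g₀ := constantCoeff g
  set e : MvPolynomial σ F := 1 - C g₀⁻¹ * g with he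
  have he0 : constantCoeff e = 0 := by
    simp [he, g₀, inv_mul_cancel₀ h0]
  -- `N` exceeds every degree `|α l|`
  set N := (Finset.univ.sup fun l => (α l).degree) + 1 with hN
  have hNl : ∀ l, (α l).degree < N := fun l =>
    Nat.lt_succ_of_le (Finset.le_sup (f := fun l => (α l).degree) (Finset.mem_univ l))
  set f : MvPolynomial σ F := C g₀⁻¹ * ∑ s ∈ Finset.range N, e ^ s with hf
  have hfg : f * g = 1 - e ^ N := by
    have h1 : C g₀⁻¹ * g = 1 - e := by rw [he]; ring
    calc f * g = (C g₀⁻¹ * g) * ∑ s ∈ Finset.range N, e ^ s := by rw [hf]; ring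
      _ = 1 - e ^ N := by rw [h1, mul_neg_geom_sum]
  -- the factorisation `f g M' = P̃ Q`
  set P : Matrix p (Fin k₀) (MvPolynomial σ F) := f • (M'.submatrix id cc * A.adjugate) with hP
  set Q : Matrix (Fin k₀) q (MvPolynomial σ F) := M'.submatrix r id with hQ
  have hPQ : P * Q = (f * g) • M' := by
    rw [hP, Matrix.smul_mul, ← hfac, smul_smul]
  -- `φ_t` does not see the difference `M' - P Q = e^N • M'`
  have hphi : M'.map (phi α t) = (P * Q).map (phi α t) := by
    ext a b
    simp only [Matrix.map_apply]
    rw [← sub_eq_zero, ← phi_sub, hPQ, Matrix.smul_apply, smul_eq_mul, hfg]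
    refine phi_eq_zero_of_coeff_eq_zero α t fun l => ?_
    have : M' a b - (1 - e ^ N) * M' a b = e ^ N * M' a b := by ring
    rw [this]
    exact coeff_pow_mul_eq_zero he0 N _ _ (hNl l)
  rw [hphi]
  exact rank_map_phi_mul_le α t P Q

end Local

/-! ## The main theorem -/

section Main

variable [Fintype σ] [DecidableEq σ] [Fintype I] [DecidableEq I] [Fintype p] [Fintype q]

/-- **Apolarity (cactus) bound for linear rank methods on a monomial chart.** Let `F` be an
infinite field, `α : I → (σ →₀ ℕ)` distinct exponents and `L : F^I → Mat_{p×q}(F)` linear with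
`rk L(χ(y)) ≤ k` at every point `χ(y) = (y^{α i})_i` of the chart. Then for every `t ∈ F^I`,
`rk L(t) ≤ k · rk H_t` where `H_t` is the Hankel matrix of `t` (`MonomialChart.hankel`) — a
linear rank method certifies at most the length of a local apolar scheme whose span contains `t`
(Buczyński 2026, Thm. 2 / Cor. 13, in coordinates). [cite: Buczynski2026, Thm. 2 and Cor. 13] -/
theorem rank_le_mul_rank_hankel [Infinite F] {α : I → σ →₀ ℕ} (hα : Function.Injective α)
    (L : (I → F) →ₗ[F] Matrix p q F) (k : ℕ) (hk : ∀ y : σ → F, (L (point α y)).rank ≤ k)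
    (t : I → F) : (L t).rank ≤ k * (hankel α t).rank := by
  classical
  -- the maximal rank `k₀ ≤ k` on the chart, attained at `c₀`
  set rk : (σ → F) → ℕ := fun y => (L (point α y)).rank with hrk
  set k₀ := Nat.findGreatest (fun j => ∃ y, rk y = j) k with hk₀
  obtain ⟨c₀, hc₀⟩ : ∃ y, rk y = k₀ :=
    Nat.findGreatest_spec (P := fun j => ∃ y, rk y = j) (hk 0) ⟨0, rfl⟩
  have hmax : ∀ y, rk y ≤ k₀ := fun y =>
    Nat.le_findGreatest (P := fun j => ∃ y, rk y = j) (hk y) ⟨y, rfl⟩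
  have hk₀k : k₀ ≤ k := Nat.findGreatest_le k
  -- a `k₀ × k₀` minor non-zero at `c₀`
  obtain ⟨r, cc, -, -, hΔ⟩ :=
    Literature.LinearAlgebra.Matrix.exists_det_submatrix_ne_zero_of_le_rank (L (point α c₀)) hc₀.ge
  set M := polyMatrix α L with hM
  set Δ : MvPolynomial σ F := (M.submatrix r cc).det with hΔdef
  have hΔeval : ∀ c, eval c Δ = ((L (point α c)).submatrix r cc).det := by
    intro c
    rw [hΔdef, RingHom.map_det, RingHom.mapMatrix_apply, ← Matrix.submatrix_map, hM,
      polyMatrix_map_eval]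
  have hΔne : Δ ≠ 0 := by
    intro h; apply hΔ; rw [← hΔeval, h, map_zero]
  -- the bound at every good translate
  set ρ := (hankel α t).rank with hρ
  set G := genericPhiMatrix α t M with hG
  have hgood : ∀ c, eval c Δ ≠ 0 → ((G.map (eval c))).rank ≤ k₀ * ρ := by
    intro c hc
    rw [hG, genericPhiMatrix_map_eval]
    refine rank_map_phi_le_of_minor α t (M.map (shift c)) ?_ r cc ?_
    · intro ι _ _ r' c' hι
      apply MvPolynomial.funext
      intro y
      rw [map_zero, RingHom.map_det, RingHom.mapMatrix_apply, ← Matrix.submatrix_map,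
        Matrix.map_map]
      have hcomp : (eval y : MvPolynomial σ F → F) ∘ (shift c) = eval (y + c) := by
        funext f'; exact eval_shift c y f'
      rw [hcomp, hM, polyMatrix_map_eval]
      exact Literature.LinearAlgebra.Matrix.det_submatrix_eq_zero_of_rank_lt_card _ _ _
        ((hmax (y + c)).trans_lt hι)
    · rw [RingHom.map_det, RingHom.mapMatrix_apply, ← Matrix.submatrix_map, Matrix.map_map]
      have hcomp : (constantCoeff : MvPolynomial σ F → F) ∘ (shift c) = eval c := by
        funext f'; exact constantCoeff_shift c f'
      rw [hcomp, hM, polyMatrix_map_eval, ← hΔeval]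
      exact hc
  -- conclude by minors of the polynomial matrix `G`, evaluated at `c = 0`
  have hG0 : G.map (eval 0) = L t := by
    rw [hG, genericPhiMatrix_map_eval]
    have h1 : M.map (shift (0 : σ → F)) = M := Matrix.ext fun a b => shift_zero _
    rw [h1, hM, map_phi_polyMatrix hα]
  refine le_trans ?_ (Nat.mul_le_mul_right ρ hk₀k)
  refine Literature.LinearAlgebra.Matrix.rank_le_of_det_submatrix_eq_zero (L t) fun r' c' => ?_
  have hpoly : (G.submatrix r' c').det * Δ = 0 := by
    apply MvPolynomial.funext
    intro c
    rw [map_zero, map_mul]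
    by_cases hc : eval c Δ = 0
    · rw [hc, mul_zero]
    · rw [RingHom.map_det, RingHom.mapMatrix_apply, ← Matrix.submatrix_map]
      rw [Literature.LinearAlgebra.Matrix.det_submatrix_eq_zero_of_rank_lt_card _ _ _
        (by simpa using Nat.lt_succ_of_le (hgood c hc)), zero_mul]
  have hmin : (G.submatrix r' c').det = 0 := (mul_eq_zero.1 hpoly).resolve_right hΔne
  have := congrArg (eval (0 : σ → F)) hmin
  rwa [map_zero, RingHom.map_det, RingHom.mapMatrix_apply, ← Matrix.submatrix_map, hG0] at this

end Main

end MonomialChart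

end Literature.Computability.AlgebraicComplexity

end
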